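import Mathlib
import HarnessLib
import Summits.Ventures.LatticeQCDFlow.Exactness.LaggedAdaptationDoeblin
import Summits.Ventures.LatticeQCDFlow.Exactness.IMHModeHolding
import Summits.Ventures.LatticeQCDFlow.Exactness.ApproxTrivializingSampler
import Summits.Ventures.LatticeQCDFlow.Scaling.AutoregressiveGaugeHeatBathColdExact

/-!
# LatticeQCDFlow / Scaling — SWITCHING THE CONDITIONER OF THE EXACT ONE-PLAQUETTE HEAT-BATH GAUGE SAMPLER ON A SCHEDULE: any sequence of the two
# samplers (`A₀ = Z/(c^{#B₀} M^{k₀})`, `A₁ = Z/(c^{#B₁} M^{k₁})`) fixed `n` updates ahead is within `(1 − min(A₀, A₁))ⁿ` of the Wilson-type law from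
# EVERY configuration — the gauge instance of `Exactness/LaggedAdaptationDoeblin`

HONEST FRAMING: exact (Metropolis-corrected) sampling algorithms for lattice gauge theory;
figures of merit are autocorrelation/cost numbers at stated couplings and volumes; no
continuum-physics claim.

Venture `LatticeQCDFlow` (cell pub-lqcd), topic `Scaling`, FANOUT row 30 (lean-1 GEN-44, theme LEARNING ON THE JOB) — OUR WORK, the gauge instance
of this generation's abstract `Exactness/LaggedAdaptationDoeblin` (a schedule of `π`-exact `ε`-Doeblin kernels, a DIFFERENT one at every step,
forgets at `(1 − ε)ⁿ` from every start).  Setting as in GEN-28's `heatBath_cold_acceptMass_eq`, TWICE: `L ≥ 2`; `w` continuous, `0 < m ≤ w ≤ M = w(1)`;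
two ranked conditioners `(B₀, t₀, rank₀)`, `(B₁, t₁, rank₁)` (two autoregressive architectures — which plaquettes are closed in closed form);
proposals `qᵢ = (F_{Bᵢ}/Z_{Bᵢ})·Haar^{⊗E}`; the common target `π = (F/Z)·Haar^{⊗E}`; the two exact samplers `Kᵢ = indepMH qᵢ wᵢ` (def-free, `hK0`, `hK1`)
with cold acceptance masses `Aᵢ = Z/(c^{#Bᵢ} M^{kᵢ})`.  A SCHEDULE `bs : List Bool` says which conditioner is used at each update — chosen by ANY rule
(validation loss, acceptance monitoring, retraining epochs) from information at least `n = |bs|` updates old, so that conditionally it is fixed.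

* **`heatBath_conditionerSchedule_real_sub_le`** — for every schedule `bs`, every configuration `U₀` and every set `S`:
  `|δ_{U₀} K_{b₁}⋯K_{bₙ}(S) − π(S)| ≤ (1 − min(A₀, A₁))ⁿ` — switching architectures on a lagged schedule keeps the guaranteed rate of the
  worse of the two from every configuration the schedule was decided from (the abstract theorem's `ε = min(A₀, A₁)`; each `Kᵢ` is `π`-exact and
  `Aᵢ·π ≤ Kᵢ(U, ·)` by `indepMH_apply_ge` at the cold mode).
* `heatBath_sampler_props` — bookkeeping per conditioner: the realised kernel IS `indepMH qᵢ wᵢ`, Markov, `π`-exact, minorised by `Aᵢ·π` with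
  `Aᵢ` in closed form.
NOT CLAIMED: anything when the schedule reads configurations less than `n` updates old (`Exactness/SelfTunedFlowChoiceBias`: biased at lag zero);
any value of `Aᵢ`.  No `def`, no `sorry`, nothing cited as a fact beyond the tree.
-/

noncomputable section

namespace Summit.Ventures.LatticeQCDFlow.Theory2.Autoregressive

open MeasureTheory ProbabilityTheory Function Finset
open scoped _root_.ENNReal
open Literature.MathematicalPhysics.QuantumFieldTheory Literature.MathematicalPhysics.QuantumLattice
open Summit.Ventures.LatticeQCDFlow.Exactness Summit.Ventures.LatticeQCDFlow.Scoring

variable {d L : ℕ} [NeZero L] {G : Type*} [Group G] [TopologicalSpace G] [IsTopologicalGroup G]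
  [CompactSpace G] [SecondCountableTopology G] [MeasurableSpace G] [BorelSpace G]

/-- **ONE CONDITIONER: THE REALISED SAMPLER IS MARKOV, `π`-EXACT AND MINORISED BY `A·π`, `A = Z/(c^{#B} M^k)`.** [ours — GEN-28's cold-mode facts +
`IMHKernel.indepMH_invariant` ∕ `indepMH_apply_ge` + `IMHModeHolding`] -/
theorem heatBath_sampler_props (hL : 2 ≤ L) {w : G → ℝ} (hw : Continuous w) {m M : ℝ} (hm0 : 0 < m)
    (hm : ∀ g, m ≤ w g) (hM : ∀ g, w g ≤ M) (hw1 : w 1 = M)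
    (B0 : Finset (Plaquette d L)) (t0 : Plaquette d L → Edge d L)
    (ht0 : ∀ p ∈ B0, t0 p ∈ ({(p.1, p.2.1.1), (p.1.shift p.2.1.1, p.2.1.2),
        (p.1.shift p.2.1.2, p.2.1.1), (p.1, p.2.1.2)} : Finset (Edge d L)))
    (rank0 : Plaquette d L → ℕ)
    (hrank0 : ∀ p ∈ B0, ∀ p' ∈ B0, p ≠ p' → t0 p ∈ ({(p'.1, p'.2.1.1), (p'.1.shift p'.2.1.1, p'.2.1.2),
        (p'.1.shift p'.2.1.2, p'.2.1.1), (p'.1, p'.2.1.2)} : Finset (Edge d L)) → rank0 p < rank0 p')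
    (π q0 : Measure (GaugeConfig d L G)) [IsProbabilityMeasure π] [IsProbabilityMeasure q0]
    (hπ : π = (Measure.pi fun _ : Edge d L => haarProbability G).withDensity fun U =>
      ENNReal.ofReal ((∏ p : Plaquette d L, w (plaquetteHolonomy U p.1 p.2.1.1 p.2.1.2)) /
        ∫ V, ∏ p : Plaquette d L, w (plaquetteHolonomy V p.1 p.2.1.1 p.2.1.2)
          ∂(Measure.pi fun _ : Edge d L => haarProbability G)))
    (hq0 : q0 = (Measure.pi fun _ : Edge d L => haarProbability G).withDensity fun U =>
      ENNReal.ofReal ((∏ p ∈ B0, w (plaquetteHolonomy U p.1 p.2.1.1 p.2.1.2)) /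
        ∫ V, ∏ p ∈ B0, w (plaquetteHolonomy V p.1 p.2.1.1 p.2.1.2)
          ∂(Measure.pi fun _ : Edge d L => haarProbability G)))
    (K0 : Kernel (GaugeConfig d L G) (GaugeConfig d L G))
    (hK0 : ∀ (U : GaugeConfig d L G) {S : Set (GaugeConfig d L G)}, MeasurableSet S → K0 U S =
      ∫⁻ V in S, imhAcceptE (fun U : GaugeConfig d L G => (((∫ V, ∏ p : Plaquette d L, w (plaquetteHolonomy V p.1 p.2.1.1 p.2.1.2) ∂(Measure.pi fun _ : Edge d L => haarProbability G)) /
          ((∫ V, ∏ p ∈ B0, w (plaquetteHolonomy V p.1 p.2.1.1 p.2.1.2)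
            ∂(Measure.pi fun _ : Edge d L => haarProbability G)) *
            ∏ p ∈ Finset.univ \ B0, w (plaquetteHolonomy U p.1 p.2.1.1 p.2.1.2))))⁻¹) U V ∂q0 +
        (1 - imhAcceptMass q0 (fun U : GaugeConfig d L G => (((∫ V, ∏ p : Plaquette d L, w (plaquetteHolonomy V p.1 p.2.1.1 p.2.1.2) ∂(Measure.pi fun _ : Edge d L => haarProbability G)) /
          ((∫ V, ∏ p ∈ B0, w (plaquetteHolonomy V p.1 p.2.1.1 p.2.1.2)
            ∂(Measure.pi fun _ : Edge d L => haarProbability G)) *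
            ∏ p ∈ Finset.univ \ B0, w (plaquetteHolonomy U p.1 p.2.1.1 p.2.1.2))))⁻¹) U) * S.indicator 1 U)
    :
    IsMarkovKernel K0 ∧ Kernel.Invariant K0 π ∧
      ∃ ε : ℝ≥0∞, ε.toReal = ((∫ V, ∏ p : Plaquette d L, w (plaquetteHolonomy V p.1 p.2.1.1 p.2.1.2) ∂(Measure.pi fun _ : Edge d L => haarProbability G)) /
        ((∫ g, w g ∂(haarProbability G)) ^ B0.card * M ^ (Finset.univ \ B0).card)) ∧ ε ≤ 1 ∧
        ∀ (U : GaugeConfig d L G) {S : Set (GaugeConfig d L G)}, MeasurableSet S → ε * π S ≤ K0 U S := by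
  obtain ⟨hA, hρq, hmax, hρm, hρpos⟩ := heatBath_cold_acceptMass_eq hL hw hm0 hm hM hw1 B0 t0 ht0 rank0 hrank0 π q0 hπ hq0
  set cold : GaugeConfig d L G := fun _ => (1 : G) with hcold
  set ρ : GaugeConfig d L G → ℝ := (fun U : GaugeConfig d L G => ((∫ V, ∏ p : Plaquette d L, w (plaquetteHolonomy V p.1 p.2.1.1 p.2.1.2) ∂(Measure.pi fun _ : Edge d L => haarProbability G)) /
          ((∫ V, ∏ p ∈ B0, w (plaquetteHolonomy V p.1 p.2.1.1 p.2.1.2)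
            ∂(Measure.pi fun _ : Edge d L => haarProbability G)) *
            ∏ p ∈ Finset.univ \ B0, w (plaquetteHolonomy U p.1 p.2.1.1 p.2.1.2)))) with hρ
  have hw0' : ∀ U, 0 < (ρ U)⁻¹ := fun U => inv_pos.2 (hρpos U)
  have hwm' : Measurable fun U => (ρ U)⁻¹ := hρm.inv
  have hπ' : (q0.withDensity fun U => ENNReal.ofReal (ρ U)⁻¹) = π := withDensity_inv_density hρm hρpos hρq
  have hKe : K0 = indepMH q0 (fun U => (ρ U)⁻¹) := by
    ext U S hS
    rw [hK0 U hS, indepMH_apply hwm' U hS]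
  haveI : Fact (Measurable fun U => (ρ U)⁻¹) := ⟨hwm'⟩
  have hone : ∫⁻ y, ENNReal.ofReal (ρ y)⁻¹ ∂q0 = ENNReal.ofReal 1 := by
    haveI : IsProbabilityMeasure (q0.withDensity fun U => ENNReal.ofReal (ρ U)⁻¹) := by rw [hπ']; infer_instance
    have h : (q0.withDensity fun U => ENNReal.ofReal (ρ U)⁻¹) Set.univ = 1 := measure_univ
    rw [withDensity_apply _ MeasurableSet.univ, Measure.restrict_univ] at h
    rw [h, ENNReal.ofReal_one]
  have hA' := imhAcceptMass_toReal_eq_of_forall_le (q := q0) hw0' cold hmax zero_le_one hone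
  refine ⟨by rw [hKe]; infer_instance, ?_, ⟨(ENNReal.ofReal (ρ cold)⁻¹)⁻¹, ?_, ?_, fun U S hS => ?_⟩⟩
  · have h := indepMH_invariant (q := q0) hwm' hw0'
    rw [hπ'] at h
    rw [hKe]; exact h
  · rw [ENNReal.toReal_inv, ENNReal.toReal_ofReal (hw0' cold).le, ← one_div, ← hA', hA]
  · rw [ENNReal.inv_le_one, ← ENNReal.ofReal_one]
    refine ENNReal.ofReal_le_ofReal ?_
    -- `1 = ∫ w dq ≤ w(cold)`: the normalised weight's maximum is at least one
    have h1 : (imhAcceptMass q0 (fun U => (ρ U)⁻¹) cold).toReal ≤ 1 :=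
      ENNReal.toReal_le_of_le_ofReal zero_le_one (by simpa using imhAcceptMass_le_one q0 (fun U => (ρ U)⁻¹) cold)
    rw [hA', div_le_one (hw0' cold)] at h1
    exact h1
  · have h := indepMH_apply_ge (q := q0) hwm' hw0' hmax U hS
    rw [hπ'] at h
    rw [hKe]; exact h

/-- **SWITCHING CONDITIONERS ON A LAGGED SCHEDULE KEEPS THE WORSE GUARANTEED RATE**: for every schedule `bs : List Bool` of the two exact heat-bath
samplers, every configuration `U₀` and every set `S`, `|δ_{U₀} K_{b₁}⋯K_{bₙ}(S) − π(S)| ≤ (1 − min(A₀, A₁))ⁿ`. [ours — `Exactness/LaggedAdaptationDoeblin.schedule_dirac_real_sub_le`] -/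
theorem heatBath_conditionerSchedule_real_sub_le (hL : 2 ≤ L) {w : G → ℝ} (hw : Continuous w) {m M : ℝ} (hm0 : 0 < m)
    (hm : ∀ g, m ≤ w g) (hM : ∀ g, w g ≤ M) (hw1 : w 1 = M)
    (B0 : Finset (Plaquette d L)) (t0 : Plaquette d L → Edge d L)
    (ht0 : ∀ p ∈ B0, t0 p ∈ ({(p.1, p.2.1.1), (p.1.shift p.2.1.1, p.2.1.2),
        (p.1.shift p.2.1.2, p.2.1.1), (p.1, p.2.1.2)} : Finset (Edge d L)))
    (rank0 : Plaquette d L → ℕ)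
    (hrank0 : ∀ p ∈ B0, ∀ p' ∈ B0, p ≠ p' → t0 p ∈ ({(p'.1, p'.2.1.1), (p'.1.shift p'.2.1.1, p'.2.1.2),
        (p'.1.shift p'.2.1.2, p'.2.1.1), (p'.1, p'.2.1.2)} : Finset (Edge d L)) → rank0 p < rank0 p')
    (B1 : Finset (Plaquette d L)) (t1 : Plaquette d L → Edge d L)
    (ht1 : ∀ p ∈ B1, t1 p ∈ ({(p.1, p.2.1.1), (p.1.shift p.2.1.1, p.2.1.2),
        (p.1.shift p.2.1.2, p.2.1.1), (p.1, p.2.1.2)} : Finset (Edge d L)))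
    (rank1 : Plaquette d L → ℕ)
    (hrank1 : ∀ p ∈ B1, ∀ p' ∈ B1, p ≠ p' → t1 p ∈ ({(p'.1, p'.2.1.1), (p'.1.shift p'.2.1.1, p'.2.1.2),
        (p'.1.shift p'.2.1.2, p'.2.1.1), (p'.1, p'.2.1.2)} : Finset (Edge d L)) → rank1 p < rank1 p')
    (π q0 q1 : Measure (GaugeConfig d L G)) [IsProbabilityMeasure π] [IsProbabilityMeasure q0] [IsProbabilityMeasure q1]
    (hπ : π = (Measure.pi fun _ : Edge d L => haarProbability G).withDensity fun U =>
      ENNReal.ofReal ((∏ p : Plaquette d L, w (plaquetteHolonomy U p.1 p.2.1.1 p.2.1.2)) /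
        ∫ V, ∏ p : Plaquette d L, w (plaquetteHolonomy V p.1 p.2.1.1 p.2.1.2)
          ∂(Measure.pi fun _ : Edge d L => haarProbability G)))
    (hq0 : q0 = (Measure.pi fun _ : Edge d L => haarProbability G).withDensity fun U =>
      ENNReal.ofReal ((∏ p ∈ B0, w (plaquetteHolonomy U p.1 p.2.1.1 p.2.1.2)) /
        ∫ V, ∏ p ∈ B0, w (plaquetteHolonomy V p.1 p.2.1.1 p.2.1.2)
          ∂(Measure.pi fun _ : Edge d L => haarProbability G)))
    (hq1 : q1 = (Measure.pi fun _ : Edge d L => haarProbability G).withDensity fun U =>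
      ENNReal.ofReal ((∏ p ∈ B1, w (plaquetteHolonomy U p.1 p.2.1.1 p.2.1.2)) /
        ∫ V, ∏ p ∈ B1, w (plaquetteHolonomy V p.1 p.2.1.1 p.2.1.2)
          ∂(Measure.pi fun _ : Edge d L => haarProbability G)))
    (K0 : Kernel (GaugeConfig d L G) (GaugeConfig d L G))
    (hK0 : ∀ (U : GaugeConfig d L G) {S : Set (GaugeConfig d L G)}, MeasurableSet S → K0 U S =
      ∫⁻ V in S, imhAcceptE (fun U : GaugeConfig d L G => (((∫ V, ∏ p : Plaquette d L, w (plaquetteHolonomy V p.1 p.2.1.1 p.2.1.2) ∂(Measure.pi fun _ : Edge d L => haarProbability G)) /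
          ((∫ V, ∏ p ∈ B0, w (plaquetteHolonomy V p.1 p.2.1.1 p.2.1.2)
            ∂(Measure.pi fun _ : Edge d L => haarProbability G)) *
            ∏ p ∈ Finset.univ \ B0, w (plaquetteHolonomy U p.1 p.2.1.1 p.2.1.2))))⁻¹) U V ∂q0 +
        (1 - imhAcceptMass q0 (fun U : GaugeConfig d L G => (((∫ V, ∏ p : Plaquette d L, w (plaquetteHolonomy V p.1 p.2.1.1 p.2.1.2) ∂(Measure.pi fun _ : Edge d L => haarProbability G)) /
          ((∫ V, ∏ p ∈ B0, w (plaquetteHolonomy V p.1 p.2.1.1 p.2.1.2)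
            ∂(Measure.pi fun _ : Edge d L => haarProbability G)) *
            ∏ p ∈ Finset.univ \ B0, w (plaquetteHolonomy U p.1 p.2.1.1 p.2.1.2))))⁻¹) U) * S.indicator 1 U)
    (K1 : Kernel (GaugeConfig d L G) (GaugeConfig d L G))
    (hK1 : ∀ (U : GaugeConfig d L G) {S : Set (GaugeConfig d L G)}, MeasurableSet S → K1 U S =
      ∫⁻ V in S, imhAcceptE (fun U : GaugeConfig d L G => (((∫ V, ∏ p : Plaquette d L, w (plaquetteHolonomy V p.1 p.2.1.1 p.2.1.2) ∂(Measure.pi fun _ : Edge d L => haarProbability G)) /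
          ((∫ V, ∏ p ∈ B1, w (plaquetteHolonomy V p.1 p.2.1.1 p.2.1.2)
            ∂(Measure.pi fun _ : Edge d L => haarProbability G)) *
            ∏ p ∈ Finset.univ \ B1, w (plaquetteHolonomy U p.1 p.2.1.1 p.2.1.2))))⁻¹) U V ∂q1 +
        (1 - imhAcceptMass q1 (fun U : GaugeConfig d L G => (((∫ V, ∏ p : Plaquette d L, w (plaquetteHolonomy V p.1 p.2.1.1 p.2.1.2) ∂(Measure.pi fun _ : Edge d L => haarProbability G)) /
          ((∫ V, ∏ p ∈ B1, w (plaquetteHolonomy V p.1 p.2.1.1 p.2.1.2)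
            ∂(Measure.pi fun _ : Edge d L => haarProbability G)) *
            ∏ p ∈ Finset.univ \ B1, w (plaquetteHolonomy U p.1 p.2.1.1 p.2.1.2))))⁻¹) U) * S.indicator 1 U)
    (bs : List Bool) (U₀ : GaugeConfig d L G) (S : Set (GaugeConfig d L G)) :
    |((bs.map fun b => if b then K1 else K0).foldl (fun (μ : Measure (GaugeConfig d L G)) (K : Kernel (GaugeConfig d L G) (GaugeConfig d L G)) => μ.bind K)
        (Measure.dirac U₀)).real S - π.real S| ≤
      (1 - min ((∫ V, ∏ p : Plaquette d L, w (plaquetteHolonomy V p.1 p.2.1.1 p.2.1.2) ∂(Measure.pi fun _ : Edge d L => haarProbability G)) /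
        ((∫ g, w g ∂(haarProbability G)) ^ B0.card * M ^ (Finset.univ \ B0).card))
        ((∫ V, ∏ p : Plaquette d L, w (plaquetteHolonomy V p.1 p.2.1.1 p.2.1.2) ∂(Measure.pi fun _ : Edge d L => haarProbability G)) /
        ((∫ g, w g ∂(haarProbability G)) ^ B1.card * M ^ (Finset.univ \ B1).card))) ^ bs.length := by
  obtain ⟨hM0, hI0, ε0, hε0, hε0le, hmin0⟩ := heatBath_sampler_props hL hw hm0 hm hM hw1 B0 t0 ht0 rank0 hrank0 π q0 hπ hq0 K0 hK0
  obtain ⟨hM1, hI1, ε1, hε1, hε1le, hmin1⟩ := heatBath_sampler_props hL hw hm0 hm hM hw1 B1 t1 ht1 rank1 hrank1 π q1 hπ hq1 K1 hK1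
  have hlen : (bs.map fun b => if b then K1 else K0).length = bs.length := List.length_map _
  have hεtop0 : ε0 ≠ ⊤ := ne_top_of_le_ne_top ENNReal.one_ne_top hε0le
  have hεtop1 : ε1 ≠ ⊤ := ne_top_of_le_ne_top ENNReal.one_ne_top hε1le
  have hmin_toReal : (min ε0 ε1).toReal = min ((∫ V, ∏ p : Plaquette d L, w (plaquetteHolonomy V p.1 p.2.1.1 p.2.1.2) ∂(Measure.pi fun _ : Edge d L => haarProbability G)) /
        ((∫ g, w g ∂(haarProbability G)) ^ B0.card * M ^ (Finset.univ \ B0).card))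
        ((∫ V, ∏ p : Plaquette d L, w (plaquetteHolonomy V p.1 p.2.1.1 p.2.1.2) ∂(Measure.pi fun _ : Edge d L => haarProbability G)) /
        ((∫ g, w g ∂(haarProbability G)) ^ B1.card * M ^ (Finset.univ \ B1).card)) := by
    rw [← hε0, ← hε1]
    rcases le_total ε0 ε1 with h | h
    · rw [min_eq_left h, min_eq_left (ENNReal.toReal_mono hεtop1 h)]
    · rw [min_eq_right h, min_eq_right (ENNReal.toReal_mono hεtop0 h)]
  rw [← hmin_toReal, ← hlen]
  refine schedule_dirac_real_sub_le (π := π) (ε := min ε0 ε1) _ (fun K hK => ?_) (fun K hK => ?_) (fun K hK => ?_) U₀ S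
  · obtain ⟨b, -, rfl⟩ := List.mem_map.1 hK
    cases b
    · exact hM0
    · exact hM1
  · obtain ⟨b, -, rfl⟩ := List.mem_map.1 hK
    cases b
    · exact hI0
    · exact hI1
  · obtain ⟨b, -, rfl⟩ := List.mem_map.1 hK
    intro U S hS
    cases b
    · exact (mul_le_mul' (min_le_left _ _) le_rfl).trans (hmin0 U hS)
    · exact (mul_le_mul' (min_le_right _ _) le_rfl).trans (hmin1 U hS)

end Summit.Ventures.LatticeQCDFlow.Theory2.Autoregressive
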